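import Mathlib
import HarnessLib
import Summits.HubbardSuperconductivity.HubbardSuperconductivity.Theorems.KLProgrammeKLRegimeEnginePairLadderRelativeFlow

/-!
# Route `KLProgramme` — crux K3, ENGINE child gen 8 (stmt-HubbardSuperconductivity-20437 `KLRegimeEngineV17F2`), stub (c) `stub_engine_step_values`,
# skeleton v2 class #5 «pair transfer»: the RELATIVE STEP in forward form — `kltc_relResidue_le_of_fwd`, `kltc_fwd_of_relResidue`, `kltc_relative_step_fwd`

Cell gate-hubbard-kl, seat hubbard-kl-k3c1-p1 (g10), technique «composed-map remainder propagation».  Sequel to `…EnginePairLadderRelativeFlow`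
(`kltc_relative_flow_duhamel`: the relative residue `Ẽ(t) = A₁ + A₁·diag a·A₂ − A₂` of two Riccati flows compared through the relative weight `a` obeys the
linearly dressed tangent flow with the RELATIVE source, hence a weighted Duhamel bound in which nothing of full size is inherited — CLASS5-DEFECT-BUDGET §4).

The class-#5 clauses are FORWARD relations `(1 + diag a·A₂)·N = 1`, `‖A₁ − A₂·N‖ ≤ R` (for the pinned text: `a := −(t[ψ₁] − t[ψ₂])`); this file converts:
* `kltc_relResidue_le_of_fwd`: forward relation ⇒ `‖Ẽ(x,y)‖ ≤ R(x,y) + Σ_c R(x,c)‖a_c‖m` (`Ẽ = (A₁ − A₂M)(1 + diag a·A₂)` for the inverse `M`; no smallness);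
* `kltc_fwd_of_relResidue`: `‖Ẽ‖ ≤ T`, `m·Σ‖a‖ ≤ 1/3` ⇒ a two-sided inverse `N` (`klcrs_single_slice`) with `‖A₁ − A₂N‖ ≤ T + Σ_c T(x,c)‖a_c‖(3m/2)` (`A₁ − A₂N = Ẽ·N`,
  `N = 1 − diag a·(A₂N)`, `|A₂N| ≤ 3m/2`);
* **`kltc_relative_step_fwd`**: history forward relation at `t = 0` (weight `a(0)`, residue `R₀`) + the two flows + the relative source majorant `I` ⟹ forward relation at
  `t = 1` (weight `a(1) = a(0) + (b₁(1)−b₁(0)) − (b₂(1)−b₂(0))`, two-sided `N`) with residue `T + Σ_c T(x,c)‖a(1)_c‖(3m/2)`, `T ≥` four-term form of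
  `S ≥ [R₀ + Σ_c R₀‖a(0)‖m] + FT_ρ(I) + (4/3)Bβ(η₁+η₂)`.  For class #5 rev 3: `A₂` = member `ψ₂`'s flow, `A₁` = member `ψ₁`'s, `R₀ = transferBarAt (n−1)·klSoftMass (n−1)(ψ₁−ψ₂)`,
  `I ≤ (slice shapes)·klSoftMass n (ψ₁−ψ₂)` (the (c) lane's per-slice input).

ANSWER TO CLASS5-COMPOSE-BUDGET §4 (p1 g12, 5aaa80e1f4db194e: «a Duhamel difference tower re-charges the old defect with coefficient 1; any per-scale
certification reads the smeared non-tree sextic tadpole sign-blind»).  (i) Yes, `kltc_relative_flow_duhamel` re-charges `Ẽ(0)` with coefficient 1 — by design: the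
relative residue of a FIXED symbol difference `δψ = ψ₁ − ψ₂` is carried in a bar that GROWS along the ladder for that fixed `δψ` (its soft mass relative to the running
scale, `klSoftMass n δψ ∝ Λₙ⁻¹`, quadruples per step while the per-step shapes shrink by at most 4), so coefficient-1 inheritance has room wherever the shape ratio is
< 4 (saturated / `Kρ4ⁿ` / caustic `2^{−n}` branches of `phGainOf`, the cubic, thermal and `1/L` slots); the two ratio-4 windows of `klEngGeo8.phGain` (the `ρ = 0` floor
`ρ < 4^{−2n}/28` and the frozen window `2^{19}·4^{−n} < ρ < 2^{−n}/6`, `n ≥ 28`) are where CLASS5-DEFECT-BUDGET-2 (the G1 satisfiability line) puts the born-overlap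
weight (floor: nothing one-loop is inherited — compact cutoff transitions cannot be bridged by `|Δe| ≤ v_Fρ`, `|Δω| ≤ 2π/β`) and the shell-count factor `1 + kₙ(ρ)`
(frozen: the one-loop mixed bubble accumulates `≍ Λ_{δψ}/ρ` per hard shell below `ρ` — the same `log₄(ρ/Λₙ)` the PLAIN slice's ph increment carries).  (ii) No naked
smeared tadpole of the accumulated non-tree sextic is read: the members' arrays obey the purely BILINEAR Wick-ordered flow (`Ḋ = −Ḣ` kills the one-line term), in
which `W₆, W₈, …` enter the pair rate only inside two-kernel blocks with one hard slice line and ≥ 2 soft lines (the E.5 blocks of class #3, sign-blind WITH the `2^{−n}`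
gain: `klE5BlockR1_slice_le_of_rows_klam`); the RELATIVE source replaces one soft line by `S_{δψ}` (mass ratio) or one kernel by its `δψ`-smearing difference
`(e^{Δ_{S_δψ}} − 1)W` (Gram route) — cubic slot, same currency and same located risk #14 exposure as the plain step's `eremBar` CR-slot, nothing beyond.  The naked
tadpole `Δ_D R_{6,n}` appears only when `e^{Δ_D} − 1` is expanded against the accumulated action AT a scale; the flow never does that above scale 0.

Matrix algebra + the landed resummation lemmas only; nothing about the model is asserted.  0 kit.
-/

noncomputable section

namespace Summit.HubbardSuperconductivity.HubbardSuperconductivity.Theorems.KLRegimeSplit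

set_option linter.dupNamespace false -- summit = problem name (single-conjunct summit), D-0017

open Finset Matrix Set
open Summit.HubbardSuperconductivity.HubbardSuperconductivity.Theorems.KLProgrammeCooperResummation

/-! ## §4 Endpoint conversions and the packaged relative step -/

section Endpoints

variable {ι : Type*} [Fintype ι] [DecidableEq ι] [Nonempty ι]

omit [Nonempty ι] in
/-- **Forward relation ⇒ relative residue.**  `M·(1 + diag a·A₂) = 1` (or the right-inverse form, `Matrix.mul_eq_one_comm`), `|A₂| ≤ m`, `‖(A₁ − A₂M)(x,y)‖ ≤ R(x,y)`
⇒ `‖(A₁ + A₁·diag a·A₂ − A₂)(x,y)‖ ≤ R(x,y) + Σ_c R(x,c)·‖a_c‖·m`. -/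
theorem kltc_relResidue_le_of_fwd (A₁ A₂ M : Matrix ι ι ℂ) (a : ι → ℂ) (R : ι → ι → ℝ) {m : ℝ}
    (hA₂ : ∀ x y, ‖A₂ x y‖ ≤ m) (hM : (1 + diagonal a * A₂) * M = 1) (hR : ∀ x y, ‖(A₁ - A₂ * M) x y‖ ≤ R x y) (x y : ι) :
    ‖(A₁ + A₁ * diagonal a * A₂ - A₂) x y‖ ≤ R x y + ∑ c, R x c * ‖a c‖ * m := by
  have hM' : M * (1 + diagonal a * A₂) = 1 := mul_eq_one_comm.mp hM
  rw [kltc_relResidue_eq_of_leftInv A₁ A₂ M a hM']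
  set T : Matrix ι ι ℂ := A₁ - A₂ * M with hT_def
  have e : (T * (1 + diagonal a * A₂)) x y = T x y + ∑ c, T x c * a c * A₂ c y := by
    rw [mul_add, mul_one, ← mul_assoc, Matrix.add_apply, klli_mul_diag_mul_apply]
  rw [e]
  refine (norm_add_le _ _).trans (add_le_add (hR x y) ?_)
  refine (norm_sum_le _ _).trans (sum_le_sum fun c _ => ?_)
  rw [norm_mul, norm_mul]
  have hR0 : 0 ≤ R x c := (norm_nonneg _).trans (hR x c)
  exact mul_le_mul (mul_le_mul_of_nonneg_right (hR x c) (norm_nonneg _)) (hA₂ c y) (norm_nonneg _) (mul_nonneg hR0 (norm_nonneg _))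

/-- **Relative residue ⇒ forward relation** (needs smallness `m·Σ‖a‖ ≤ 1/3`): a two-sided inverse `N` of `1 + diag a·A₂` with
`‖(A₁ − A₂·N)(x,y)‖ ≤ T(x,y) + Σ_c T(x,c)·‖a_c‖·(3m/2)` whenever `‖(A₁ + A₁·diag a·A₂ − A₂)(x,y)‖ ≤ T(x,y)`. -/
theorem kltc_fwd_of_relResidue (A₁ A₂ : Matrix ι ι ℂ) (a : ι → ℂ) (T : ι → ι → ℝ) {m : ℝ} (hm : 0 ≤ m)
    (hA₂ : ∀ x y, ‖A₂ x y‖ ≤ m) (hsm : m * ∑ c, ‖a c‖ ≤ 1 / 3)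
    (hT : ∀ x y, ‖(A₁ + A₁ * diagonal a * A₂ - A₂) x y‖ ≤ T x y) :
    ∃ N : Matrix ι ι ℂ, (1 + diagonal a * A₂) * N = 1 ∧ N * (1 + diagonal a * A₂) = 1 ∧
      ∀ x y, ‖(A₁ - A₂ * N) x y‖ ≤ T x y + ∑ c, T x c * ‖a c‖ * (3 / 2 * m) := by
  obtain ⟨N, N₀, hN1, hN2, -, -, -, -, -, hCN, -, -⟩ := klcrs_single_slice a hm A₂ hA₂ hsm
  refine ⟨N, hN1, hN2, fun x y => ?_⟩
  rw [← kltc_relResidue_mul_rightInv A₁ A₂ N a hN1]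
  set Et : Matrix ι ι ℂ := A₁ + A₁ * diagonal a * A₂ - A₂ with hEt_def
  -- `N = 1 − diag a·(A₂N)`
  have hNexp : N = 1 - diagonal a * (A₂ * N) := klli_rightInv_expand A₂ (diagonal a) N hN1
  have e : (Et * N) x y = Et x y - ∑ c, Et x c * a c * (A₂ * N) c y := by
    conv_lhs => rw [hNexp]
    rw [mul_sub, mul_one, Matrix.sub_apply, ← mul_assoc, klli_mul_diag_mul_apply]
  rw [e]
  refine (norm_sub_le _ _).trans (add_le_add (hT x y) ?_)
  refine (norm_sum_le _ _).trans (sum_le_sum fun c _ => ?_)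
  rw [norm_mul, norm_mul]
  have hT0 : 0 ≤ T x c := (norm_nonneg _).trans (hT x c)
  exact mul_le_mul (mul_le_mul_of_nonneg_right (hT x c) (norm_nonneg _)) (hCN c y) (norm_nonneg _) (mul_nonneg hT0 (norm_nonneg _))

set_option maxHeartbeats 800000 in -- long hypothesis list; plumbing
/-- **The packaged relative step (forward form in, forward form out).**  History: `(1 + diag a(0)·A₂(0))·M₀ = 1`, `‖(A₁(0) − A₂(0)M₀)(x,y)‖ ≤ R₀(x,y)`,
`R₀(x,y) + Σ_c R₀(x,c)‖a(0)_c‖m ≤ δ`; the two flows and the relative source data as in `kltc_relative_flow_duhamel`; majorants `S ≥ [R₀ + Σ R₀‖a(0)‖m] + FT_ρ(I) +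
(4/3)Bβ(η₁+η₂)` and `T ≥` the four-term form of `S`; endpoint smallness `m·Σ‖a(1)‖ ≤ 1/3`.  THEN a two-sided inverse `N` of `1 + diag a(1)·A₂(1)` with
`‖(A₁(1) − A₂(1)·N)(x,y)‖ ≤ T(x,y) + Σ_c T(x,c)‖a(1)_c‖(3m/2)`. -/
theorem kltc_relative_step_fwd (A₁ A₁' A₂ A₂' S₁ S₂ : ℝ → Matrix ι ι ℂ) (b₁ b₂ b₁' b₂' a : ℝ → ι → ℂ) (ρ₁ ρ₂ : ι → ℝ)
    (M₀ : Matrix ι ι ℂ) (R₀ I S T : ι → ι → ℝ) {m β δ ξ ξ₁ ξ₂ : ℝ} (hm : 0 ≤ m) (hδ : 0 ≤ δ) (hξ : 0 ≤ ξ) (hξ₁ : 0 ≤ ξ₁) (hξ₂ : 0 ≤ ξ₂)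
    (hA₁ : ∀ t ∈ Icc (0 : ℝ) 1, ∀ x y, HasDerivAt (fun s => A₁ s x y) (A₁' t x y) t)
    (hA₂ : ∀ t ∈ Icc (0 : ℝ) 1, ∀ x y, HasDerivAt (fun s => A₂ s x y) (A₂' t x y) t)
    (hb₁ : ∀ t ∈ Icc (0 : ℝ) 1, ∀ c, HasDerivAt (fun s => b₁ s c) (b₁' t c) t)
    (hb₂ : ∀ t ∈ Icc (0 : ℝ) 1, ∀ c, HasDerivAt (fun s => b₂ s c) (b₂' t c) t)
    (ha : ∀ t ∈ Icc (0 : ℝ) 1, ∀ c, HasDerivAt (fun s => a s c) (b₁' t c - b₂' t c) t)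
    (hb₁'c : ∀ c, ContinuousOn (fun t => b₁' t c) (Icc 0 1)) (hb₂'c : ∀ c, ContinuousOn (fun t => b₂' t c) (Icc 0 1))
    (hS₁c : ∀ x y, ContinuousOn (fun t => S₁ t x y) (Icc 0 1)) (hS₂c : ∀ x y, ContinuousOn (fun t => S₂ t x y) (Icc 0 1))
    (hflow₁ : ∀ t ∈ Icc (0 : ℝ) 1, A₁' t = -(A₁ t * diagonal (b₁' t) * A₁ t) + S₁ t)
    (hflow₂ : ∀ t ∈ Icc (0 : ℝ) 1, A₂' t = -(A₂ t * diagonal (b₂' t) * A₂ t) + S₂ t)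
    (hA₁m : ∀ t ∈ Icc (0 : ℝ) 1, ∀ x y, ‖A₁ t x y‖ ≤ m) (hA₂m : ∀ t ∈ Icc (0 : ℝ) 1, ∀ x y, ‖A₂ t x y‖ ≤ m)
    (hβ₁ : ∀ t ∈ Icc (0 : ℝ) 1, ∑ c, ‖b₁' t c‖ ≤ β) (hβ₂ : ∀ t ∈ Icc (0 : ℝ) 1, ∑ c, ‖b₂' t c‖ ≤ β)
    (hρ₁ : ∀ t ∈ Icc (0 : ℝ) 1, ∀ c, ‖b₁ t c - b₁ 0 c‖ ≤ ρ₁ c) (hρ₂ : ∀ t ∈ Icc (0 : ℝ) 1, ∀ c, ‖b₂ t c - b₂ 0 c‖ ≤ ρ₂ c)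
    (hmβ : m * β ≤ 1 / 3) (hZ₁ : m * ∑ c, ρ₁ c ≤ 1 / 3) (hZ₂ : m * ∑ c, ρ₂ c ≤ 1 / 3)
    (hS₁ : ∀ t ∈ Icc (0 : ℝ) 1, ∀ x y, ‖S₁ t x y‖ ≤ ξ₁) (hS₂ : ∀ t ∈ Icc (0 : ℝ) 1, ∀ x y, ‖S₂ t x y‖ ≤ ξ₂)
    (hM₀ : (1 + diagonal (a 0) * A₂ 0) * M₀ = 1) (hR₀ : ∀ x y, ‖(A₁ 0 - A₂ 0 * M₀) x y‖ ≤ R₀ x y)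
    (hR₀δ : ∀ x y, R₀ x y + ∑ c, R₀ x c * ‖a 0 c‖ * m ≤ δ)
    (hXξ : ∀ t ∈ Icc (0 : ℝ) 1, ∀ x y, ‖(S₁ t * (1 + diagonal (a t) * A₂ t) + A₁ t * diagonal (a t) * S₂ t - S₂ t) x y‖ ≤ ξ)
    (hI : ∀ x y, (∫ t in (0 : ℝ)..1, ‖(S₁ t * (1 + diagonal (a t) * A₂ t) + A₁ t * diagonal (a t) * S₂ t - S₂ t) x y‖) ≤ I x y)
    (hS : ∀ x y, (R₀ x y + ∑ c, R₀ x c * ‖a 0 c‖ * m) +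
        (I x y + ∑ c, I x c * ρ₂ c * m + ∑ a', m * ρ₁ a' * I a' y + ∑ a', ∑ c, m * ρ₁ a' * I a' c * ρ₂ c * m) +
        4 / 3 * (δ * Real.exp (m * β + m * β) + 2 * ξ) * β * (8 / 3 * ξ₁ + 8 / 3 * ξ₂) ≤ S x y)
    (hT : ∀ x y, S x y + ∑ c, S x c * ρ₂ c * (3 / 2 * m) + ∑ a', 3 / 2 * m * ρ₁ a' * S a' y +
        ∑ a', ∑ c, 3 / 2 * m * ρ₁ a' * S a' c * ρ₂ c * (3 / 2 * m) ≤ T x y)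
    (hsm₁ : m * ∑ c, ‖a 1 c‖ ≤ 1 / 3) :
    ∃ N : Matrix ι ι ℂ, (1 + diagonal (a 1) * A₂ 1) * N = 1 ∧ N * (1 + diagonal (a 1) * A₂ 1) = 1 ∧
      ∀ x y, ‖(A₁ 1 - A₂ 1 * N) x y‖ ≤ T x y + ∑ c, T x c * ‖a 1 c‖ * (3 / 2 * m) := by
  have h01 : (0 : ℝ) ∈ Icc (0 : ℝ) 1 := ⟨le_rfl, zero_le_one⟩
  have h11 : (1 : ℝ) ∈ Icc (0 : ℝ) 1 := ⟨zero_le_one, le_rfl⟩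
  -- history: forward relation ⇒ relative residue at `t = 0`
  have hE0' : ∀ x y, ‖(A₁ 0 + A₁ 0 * diagonal (a 0) * A₂ 0 - A₂ 0) x y‖ ≤ R₀ x y + ∑ c, R₀ x c * ‖a 0 c‖ * m :=
    kltc_relResidue_le_of_fwd (A₁ 0) (A₂ 0) M₀ (a 0) R₀ (hA₂m 0 h01) hM₀ hR₀
  have hE0 : ∀ x y, ‖(A₁ 0 + A₁ 0 * diagonal (a 0) * A₂ 0 - A₂ 0) x y‖ ≤ δ := fun x y => (hE0' x y).trans (hR₀δ x y)
  have hS' : ∀ x y, ‖(A₁ 0 + A₁ 0 * diagonal (a 0) * A₂ 0 - A₂ 0) x y‖ +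
      (I x y + ∑ c, I x c * ρ₂ c * m + ∑ a', m * ρ₁ a' * I a' y + ∑ a', ∑ c, m * ρ₁ a' * I a' c * ρ₂ c * m) +
      4 / 3 * (δ * Real.exp (m * β + m * β) + 2 * ξ) * β * (8 / 3 * ξ₁ + 8 / 3 * ξ₂) ≤ S x y :=
    fun x y => le_trans (by linarith [hE0' x y]) (hS x y)
  -- the flow
  have hE1 : ∀ x y, ‖(A₁ 1 + A₁ 1 * diagonal (a 1) * A₂ 1 - A₂ 1) x y‖ ≤ T x y := fun x y =>
    (kltc_relative_flow_duhamel A₁ A₁' A₂ A₂' S₁ S₂ b₁ b₂ b₁' b₂' a ρ₁ ρ₂ I S hm hδ hξ hξ₁ hξ₂ hA₁ hA₂ hb₁ hb₂ ha hb₁'c hb₂'c hS₁c hS₂c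
      hflow₁ hflow₂ hA₁m hA₂m hβ₁ hβ₂ hρ₁ hρ₂ hmβ hZ₁ hZ₂ hS₁ hS₂ hE0 hXξ hI hS' x y).trans (hT x y)
  -- relative residue ⇒ forward relation at `t = 1`
  exact kltc_fwd_of_relResidue (A₁ 1) (A₂ 1) (a 1) T hm (hA₂m 1 h11) hsm₁ hE1

end Endpoints

end Summit.HubbardSuperconductivity.HubbardSuperconductivity.Theorems.KLRegimeSplit

end
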